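import Summits.Ventures.HSemireg.PhaseTorusLawProof

/-!
# BOX LAW ∕ μ-lattice theorem on the phase torus `(μ₄)⁴`: every clean signed measure has box masses `32·N(s) = −Re(e(−Σs)·μ)`,
# hence `μ = −32·(N(0) + i·N(e₀))`, and for INTEGER measures `μ ∈ 32ℤ[i]`, `μ ≠ 0 ⇒ ‖μ‖ ≥ 32`
# (HSemireg support file; phase-torus line, «control» lens g6 CYCLE LINE «BOX LAW ∕ μ-LATTICE», torus level, module 1 of 2)

Crux of record: `Summit.HodgeConjecture.HodgeConjecture.Theses.EightfoldBlochSeeds.BlochSeedDiscOne`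
(= `HasHyperbolicBlochSeed 4 1`, item stmt-HodgeConjecture-18881; skeleton `Lines/birth.lean`, STUB R `stub_rung_pad4_seedAt`,
named technique = PAD-4 two-level ⊕-block design with a TWO-TERM line-bundle presentation).
Nothing in this file proves HC, HC_AV, HC_CM, H2 or item 18881; census-neutral (no SAT∕UNSAT row is added or changed).

WHAT THIS FILE IS (tree copy of §1–§5 of the crux workfile `Cruxes/BlochSeedDiscOne/PhaseTorusBoxLaw.lean` 7f939b9519446d9e, author
plan-lens-HodgeAV-control g6, statements verbatim; pen proof + data 41∕41 designs of record: memo `Cruxes/BlochSeedDiscOne/BOX-LAW-g6.md`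
§2; director-hodge word «K-μ32» (torus half); critic idea-crit-6 g12 KERNEL PLATE on the crux-dir bytes).  For a real signed measure `ω`
on the phase torus `PT = (ℤ∕4)⁴` whose CLEAN moments vanish (`KAdm k → moment ω k = 0`, the 79 admissible frequencies of
`PhaseTorusLaw.lean`) and `μ = moment ω (1,1,1,1)`:
* §1 `pbox s = ∏_f {s_f, s_f + 1}` (16 points), `slab S s` (boxed on `S ⊆ Fin 4`, free elsewhere), `boxSum ω s = N(s)`;
* §2 the pair indicator `1_{{s,s+1}} = 1 − ½·bumpPair s` (`boxInd_eq`) and its frequency table `coefBox s` = (`½`, `−conj(z_s)∕4`, `0`,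
  `−z_s∕4`) — NO frequency `2` (`coefBox_two`), conjugate-symmetric (`coefBox_three_eq_conj`), `boxInd_expand`;
* §3 the slab test function `∏_f uvec` with coefficient tables `svec` and the REDUCED PAIRING `Σ_τ ω·1_slab = 2·Re((∏_f svec_f(1))·μ)`
  (`slab_pairing`, from `PhaseTorusLaw.pairing_expansion` exactly as `PhaseTorusLawProof.rot_step`: the frequency-2-free tables meet
  `ω` only through the two top moments);
* §4 the top coefficient: `0` for a proper slab (`prod_svec_one_of_ne`), `−e(−Σ s)∕64` for a full box (`prod_svec_one_univ`);
* §5 **`slabLaw`** (every proper slab has mass `0`), **`boxSumLaw`** (`32·N(s) = −Re(e(−Σ_f s_f)·μ)`; named `boxLaw` in the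
  workfile — renamed here because the tree name `PhaseTorus.boxLaw` is the HOSTED-SET law of `Pad4TowerLineStaticSpread`), **`moment_one_eq_boxSums`**
  (`μ = −32·(N(0) + i·N(e₀))`), and for INTEGER `ω`: **`moment_one_mem_32`** (`μ ∈ 32ℤ ⊕ 32ℤ·i`), **`norm_moment_one_ge`**
  (`μ ≠ 0 ⇒ ‖μ‖ ≥ 32`).
Everything here is PROVED (axioms `propext`, `Classical.choice`, `Quot.sound`; no `sorry`, no named fact, no instance, no notation).

WHAT IT IS NOT: a statement about sheaves, monads, the semi-homogeneous alphabet, a SOURCE or a SEED; no cardinality ∕ corank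
hypothesis and no sign hypothesis enter — the laws hold for EVERY clean `ω`.  The corank-10 phase-torus law (double counting over one
box class) is the sequel `PhaseTorusLawTen`; the DESIGN-level dictionary (μ of an integer (A1)-clean LINE design `= −32·(N₀ + i·N₁)`,
director word «K-μ32») is `Pad4TowerLineBoxLaw`.
Tree filing: hsemireg-phasetorus-typer-1 g2.
-/

namespace Summit.Ventures.HSemireg.PhaseTorus

open Finset BigOperators

/-! ## §1 boxes and slabs -/

/-- the phase BOX with corner `s`: `∏_f {s_f, s_f + 1}` (16 points of the torus). -/
def pbox (s : PT) : Finset PT := Finset.univ.filter fun τ => ∀ f, τ f = s f ∨ τ f = s f + 1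

/-- the SLAB boxed on the coordinates in `S`, free elsewhere. -/
def slab (S : Finset (Fin 4)) (s : PT) : Finset PT := Finset.univ.filter fun τ => ∀ f ∈ S, τ f = s f ∨ τ f = s f + 1

/-- signed mass of `ω` in the pbox with corner `s`. -/
def boxSum (ω : PT → ℝ) (s : PT) : ℝ := ∑ τ ∈ pbox s, ω τ

/-- membership in a pbox, coordinatewise. -/
theorem mem_pbox {s τ : PT} : τ ∈ pbox s ↔ ∀ f, τ f = s f ∨ τ f = s f + 1 := by
  simp [pbox]

/-- membership in a slab, coordinatewise on `S`. -/
theorem mem_slab {S : Finset (Fin 4)} {s τ : PT} : τ ∈ slab S s ↔ ∀ f ∈ S, τ f = s f ∨ τ f = s f + 1 := by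
  simp [slab]

/-- a pbox is the slab boxed on all four coordinates. -/
theorem pbox_eq_slab_univ (s : PT) : pbox s = slab Finset.univ s := by
  ext τ; simp [mem_pbox, mem_slab]

/-! ## §2 the pair indicator `1_{{s,s+1}} = 1 − ½ bumpPair s` and its frequency table `coefBox` -/

/-- indicator of the adjacent pair `{s, s+1}`. -/
noncomputable def boxInd (s t : ZMod 4) : ℝ := if t = s ∨ t = s + 1 then 1 else 0

/-- `1_{{s,s+1}} = 1 − ½·bumpPair s`. -/
theorem boxInd_eq (s t : ZMod 4) : boxInd s t = 1 - bumpPair s t / 2 := by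
  unfold boxInd bumpPair; split_ifs <;> norm_num

/-- the pair indicator is non-negative. -/
theorem boxInd_nonneg (s t : ZMod 4) : 0 ≤ boxInd s t := by
  unfold boxInd; split_ifs <;> norm_num

/-- frequency table of `boxInd s`: `1/2` at `0`, `−conj(z_s)/4` at `1`, `−z_s/4` at `3`, `0` at `2`. -/
noncomputable def coefBox (s j : ZMod 4) : ℂ :=
  if j = 0 then 1 / 2 else if j = 1 then -(starRingEnd ℂ) (zPair s) / 4 else if j = 3 then -zPair s / 4 else 0

/-- `coefBox s = [· = 0] − ½·coefPair s`. -/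
theorem coefBox_eq (s j : ZMod 4) : coefBox s j = (if j = 0 then (1 : ℂ) else 0) - coefPair s j / 2 := by
  rcases (by decide : ∀ x : ZMod 4, x = 0 ∨ x = 1 ∨ x = 2 ∨ x = 3) j with rfl | rfl | rfl | rfl
  · rw [if_pos rfl, coefPair_zero]; simp [coefBox]; norm_num
  · rw [if_neg (by decide), coefPair_one]; simp [coefBox, show (1 : ZMod 4) ≠ 0 from by decide]; ring
  · rw [if_neg (by decide), coefPair_two]
    simp [coefBox, show (2 : ZMod 4) ≠ 0 from by decide, show (2 : ZMod 4) ≠ 1 from by decide,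
      show (2 : ZMod 4) ≠ 3 from by decide]
  · rw [if_neg (by decide), coefPair_three]
    simp [coefBox, show (3 : ZMod 4) ≠ 0 from by decide, show (3 : ZMod 4) ≠ 1 from by decide]; ring


/-- the frequency-`1` coefficient of the pair indicator: `−conj(z_s)∕4`. -/
theorem coefBox_one (s : ZMod 4) : coefBox s 1 = -(starRingEnd ℂ) (zPair s) / 4 := by
  simp [coefBox, show (1 : ZMod 4) ≠ 0 from by decide]

/-- the pair indicator has NO frequency-`2` component. -/
theorem coefBox_two (s : ZMod 4) : coefBox s 2 = 0 := by
  rw [coefBox_eq, if_neg (by decide), coefPair_two]; simp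

/-- the frequency-`3` coefficient is the conjugate of the frequency-`1` one. -/
theorem coefBox_three_eq_conj (s : ZMod 4) : coefBox s 3 = (starRingEnd ℂ) (coefBox s 1) := by
  rw [coefBox_eq, coefBox_eq, if_neg (by decide), if_neg (by decide), coefPair_three_eq_conj, map_sub, map_zero,
    map_div₀]
  congr 2
  exact (Complex.conj_ofNat 2).symm

/-- the three-term character expansion of the pair indicator. -/
theorem boxInd_expand (s t : ZMod 4) :
    (boxInd s t : ℂ) = ∑ j : ZMod 4, coefBox s j * Complex.I ^ ((j * t).val) := by
  have hA : ∑ j : ZMod 4, (if j = 0 then (1 : ℂ) else 0) * Complex.I ^ ((j * t).val) = 1 := by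
    rw [Finset.sum_eq_single (0 : ZMod 4)]
    · simp
    · intro j _ hj; rw [if_neg hj, zero_mul]
    · intro h; exact absurd (Finset.mem_univ _) h
  have hB : ∑ j : ZMod 4, coefBox s j * Complex.I ^ ((j * t).val) =
      1 - (∑ j : ZMod 4, coefPair s j * Complex.I ^ ((j * t).val)) / 2 := by
    rw [Finset.sum_div, ← hA, ← Finset.sum_sub_distrib]
    refine Finset.sum_congr rfl fun j _ => ?_
    rw [coefBox_eq]; ring
  rw [hB, ← bumpPair_expand, boxInd_eq]; push_cast; ring

/-- frequency table of the constant function `1` (a free coordinate). -/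
noncomputable def coefOne (j : ZMod 4) : ℂ := if j = 0 then 1 else 0

/-- the one-term character expansion of the constant `1`. -/
theorem one_expand (t : ZMod 4) : ((1 : ℝ) : ℂ) = ∑ j : ZMod 4, coefOne j * Complex.I ^ ((j * t).val) := by
  rw [Finset.sum_eq_single (0 : ZMod 4)]
  · simp [coefOne]
  · intro j _ hj; rw [coefOne, if_neg hj, zero_mul]
  · intro h; exact absurd (Finset.mem_univ _) h

/-! ## §3 the slab test function: coefficient vectors `svec`, values `uvec`, the reduced pairing -/

/-- coefficient tables of the slab indicator: `coefBox (s f)` on boxed coordinates, `coefOne` on free ones. -/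
noncomputable def svec (S : Finset (Fin 4)) (s : PT) (f : Fin 4) : ZMod 4 → ℂ :=
  if f ∈ S then coefBox (s f) else coefOne

/-- values of the factors of the slab indicator. -/
noncomputable def uvec (S : Finset (Fin 4)) (s : PT) (f : Fin 4) (t : ZMod 4) : ℝ :=
  if f ∈ S then boxInd (s f) t else 1

/-- the coefficient tables have no frequency `2`. -/
theorem svec_two (S : Finset (Fin 4)) (s : PT) (f : Fin 4) : svec S s f 2 = 0 := by
  unfold svec coefOne; split_ifs
  · exact coefBox_two _
  · simp [show (2 : ZMod 4) ≠ 0 from by decide]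

/-- the coefficient tables are conjugate-symmetric (`3 ↔ 1`). -/
theorem svec_three (S : Finset (Fin 4)) (s : PT) (f : Fin 4) :
    svec S s f 3 = (starRingEnd ℂ) (svec S s f 1) := by
  unfold svec coefOne; split_ifs
  · exact coefBox_three_eq_conj _
  · simp [show (3 : ZMod 4) ≠ 0 from by decide, show (1 : ZMod 4) ≠ 0 from by decide]

/-- each factor of the slab test function is the trigonometric polynomial of its table. -/
theorem trig_svec (S : Finset (Fin 4)) (s : PT) (f : Fin 4) (t : ZMod 4) :
    ∑ j : ZMod 4, svec S s f j * Complex.I ^ ((j * t).val) = (uvec S s f t : ℂ) := by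
  unfold svec uvec; split_ifs
  · exact (boxInd_expand _ t).symm
  · exact (one_expand t).symm

/-- the product of the factor values is the slab indicator. -/
theorem prod_uvec_eq (S : Finset (Fin 4)) (s τ : PT) :
    ∏ f, uvec S s f (τ f) = if (∀ f, f ∈ S → (τ f = s f ∨ τ f = s f + 1)) then 1 else 0 := by
  have h : ∀ f, uvec S s f (τ f) = if (f ∈ S → (τ f = s f ∨ τ f = s f + 1)) then (1 : ℝ) else 0 := by
    intro f; unfold uvec boxInd; by_cases hf : f ∈ S <;> simp [hf]
  simp_rw [h]
  rw [Finset.prod_boole]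
  simp

/-- **reduced pairing**: `Σ_τ ω τ · 1_slab(τ) = 2 Re( (∏_f svec_f(1)) · μ )` for clean `ω`. -/
theorem slab_pairing (ω : PT → ℝ) (hK : ∀ k, KAdm k → moment ω k = 0) (S : Finset (Fin 4)) (s : PT) :
    ∑ τ : PT, ω τ * ∏ f, uvec S s f (τ f) = 2 * ((∏ f, svec S s f 1) * moment ω (fun _ => 1)).re := by
  have hS := pairing_expansion ω (svec S s)
  have hred : ∑ k : PT, (∏ f, svec S s f (k f)) * moment ω k =
      (∏ f, svec S s f 1) * moment ω (fun _ => 1) + (∏ f, svec S s f 3) * moment ω (fun _ => 3) := by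
    have hne : (fun _ => (1 : ZMod 4) : PT) ≠ (fun _ => 3) := fun h => absurd (congr_fun h 0) (by decide)
    rw [Finset.sum_eq_add (fun _ => (1 : ZMod 4)) (fun _ => (3 : ZMod 4)) hne]
    · intro k _ hk
      by_cases h : ∃ f, k f = 2
      · obtain ⟨f, hf⟩ := h
        rw [Finset.prod_eq_zero (Finset.mem_univ f) (by rw [hf, svec_two]), zero_mul]
      · rw [hK k ⟨fun f hf => h ⟨f, hf⟩, hk.1, hk.2⟩, mul_zero]
    · intro h; exact absurd (Finset.mem_univ _) h
    · intro h; exact absurd (Finset.mem_univ _) h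
  have hc3 : ∏ f, svec S s f 3 = (starRingEnd ℂ) (∏ f, svec S s f 1) := by
    rw [map_prod]; exact Finset.prod_congr rfl fun f _ => svec_three S s f
  rw [hred, hc3, moment_three_eq_conj_moment_one, ← map_mul, Complex.add_conj] at hS
  have hreal : ∑ τ : PT, (ω τ : ℂ) * ∏ f, (∑ j : ZMod 4, svec S s f j * Complex.I ^ ((j * τ f).val)) =
      ((∑ τ : PT, ω τ * ∏ f, uvec S s f (τ f) : ℝ) : ℂ) := by
    push_cast
    refine Finset.sum_congr rfl fun τ _ => ?_
    congr 1
    exact Finset.prod_congr rfl fun f _ => trig_svec S s f (τ f)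
  rw [hreal] at hS
  exact_mod_cast hS

/-- the slab sum as a pairing with the product test function. -/
theorem slabSum_eq_pairing (ω : PT → ℝ) (S : Finset (Fin 4)) (s : PT) :
    ∑ τ ∈ slab S s, ω τ = ∑ τ, ω τ * ∏ f, uvec S s f (τ f) := by
  rw [slab, Finset.sum_filter]
  refine Finset.sum_congr rfl fun τ _ => ?_
  rw [prod_uvec_eq]
  split_ifs <;> simp

/-! ## §4 the frequency-`(1,1,1,1)` coefficient of a slab∕pbox indicator -/

/-- the constant `1` has no frequency-`1` component. -/
theorem coefOne_one : coefOne 1 = 0 := by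
  simp [coefOne, show (1 : ZMod 4) ≠ 0 from by decide]

/-- a proper slab has no top-frequency component. -/
theorem prod_svec_one_of_ne {S : Finset (Fin 4)} (hS : S ≠ Finset.univ) (s : PT) : ∏ f, svec S s f 1 = 0 := by
  obtain ⟨f, hf⟩ : ∃ f, f ∉ S := by
    by_contra h
    push Not at h
    exact hS (Finset.eq_univ_of_forall h)
  exact Finset.prod_eq_zero (Finset.mem_univ f) (by simp [svec, hf, coefOne_one])

/-- `conj(z_s) = (−1 + i)·e(−s)`. -/
theorem conj_zPair (s : ZMod 4) : (starRingEnd ℂ) (zPair s) = (-1 + Complex.I) * e (-s) := by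
  unfold zPair
  rw [map_mul, e_neg]
  congr 1
  rw [map_sub, map_neg, map_one, Complex.conj_I]; ring

/-- `coefBox s 1 = (1 − i)∕4 · e(−s)`. -/
theorem coefBox_one_eq (s : ZMod 4) : coefBox s 1 = (1 - Complex.I) / 4 * e (-s) := by
  rw [coefBox_one, conj_zPair]; ring

/-- `((1 − i)∕4)⁴ = −1∕64`. -/
theorem quarter_pow_four : ((1 - Complex.I) / 4) ^ 4 = -1 / 64 := by
  have hI : Complex.I ^ 2 = -1 := Complex.I_sq
  linear_combination (Complex.I ^ 2 - 4 * Complex.I + 5) / 256 * hI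

/-- the top-frequency coefficient of a full pbox: `−e(−Σ s)/64`. -/
theorem prod_svec_one_univ (s : PT) : ∏ f, svec Finset.univ s f 1 = -(e (-∑ f, s f)) / 64 := by
  have h : ∀ f, svec Finset.univ s f 1 = (1 - Complex.I) / 4 * e ((fun f => -s f) f) := fun f => by
    simp [svec, coefBox_one_eq]
  simp_rw [h]
  rw [Finset.prod_mul_distrib, Finset.prod_const, Finset.card_univ, Fintype.card_fin, quarter_pow_four, ← e_sum,
    Finset.sum_neg_distrib]
  ring

/-! ## §5 the laws -/

/-- **SLAB LAW**: a clean measure has mass `0` in every proper slab. -/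
theorem slabLaw (ω : PT → ℝ) (hK : ∀ k, KAdm k → moment ω k = 0) (S : Finset (Fin 4)) (hS : S ≠ Finset.univ)
    (s : PT) : ∑ τ ∈ slab S s, ω τ = 0 := by
  rw [slabSum_eq_pairing, slab_pairing ω hK S s, prod_svec_one_of_ne hS, zero_mul, Complex.zero_re, mul_zero]

/-- **BOX LAW** (box-mass form; `boxLaw` in the crux workfile): `32 · N(s) = −Re(e(−Σ s) · μ)`. -/
theorem boxSumLaw (ω : PT → ℝ) (hK : ∀ k, KAdm k → moment ω k = 0) (s : PT) :
    32 * boxSum ω s = -(e (-∑ f, s f) * moment ω (fun _ => 1)).re := by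
  rw [boxSum, pbox_eq_slab_univ, slabSum_eq_pairing, slab_pairing ω hK Finset.univ s, prod_svec_one_univ]
  rw [show -(e (-∑ f, s f)) / 64 * moment ω (fun _ => 1) = ((-(1 / 64) : ℝ) : ℂ) * (e (-∑ f, s f) * moment ω (fun _ => 1)) by
    push_cast; ring, Complex.re_ofReal_mul]
  ring

/-- `e(−1) = −i`. -/
theorem e_neg_one : e (-1) = -Complex.I := by
  rw [show (-1 : ZMod 4) = 3 from by decide, e_three]

/-- `Σ_f e₀(f) = 1` for the first basis vector `e₀ = Pi.single 0 1`. -/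
theorem sum_single_zero_one : ∑ f, (Pi.single (0 : Fin 4) (1 : ZMod 4) : PT) f = 1 := by
  rw [Fin.sum_univ_four]; simp

/-- **μ = −32 · (N(0) + i · N(e₀))**. -/
theorem moment_one_eq_boxSums (ω : PT → ℝ) (hK : ∀ k, KAdm k → moment ω k = 0) :
    moment ω (fun _ => 1) = -32 * ((boxSum ω 0 : ℂ) + (boxSum ω (Pi.single 0 1) : ℂ) * Complex.I) := by
  have h0 := boxSumLaw ω hK 0
  have h1 := boxSumLaw ω hK (Pi.single 0 1)
  simp only [Pi.zero_apply, Finset.sum_const_zero, neg_zero, e_zero, one_mul] at h0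
  rw [sum_single_zero_one, e_neg_one] at h1
  have h1' : 32 * boxSum ω (Pi.single 0 1) = -(moment ω (fun _ => 1)).im := by
    rw [h1]; simp
  apply Complex.ext
  · simp; linarith
  · simp; linarith

/-- the box mass of an integer measure is an integer. -/
theorem boxSum_intCast (ω : PT → ℤ) (s : PT) :
    boxSum (fun τ => (ω τ : ℝ)) s = ((∑ τ ∈ pbox s, ω τ : ℤ) : ℝ) := by
  unfold boxSum; push_cast; rfl

/-- **integrality**: for an integer clean measure, `μ ∈ 32ℤ[i]`. -/
theorem moment_one_mem_32 (ω : PT → ℤ) (hK : ∀ k, KAdm k → moment (fun τ => (ω τ : ℝ)) k = 0) :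
    ∃ a b : ℤ, moment (fun τ => (ω τ : ℝ)) (fun _ => 1) = ((32 * a : ℤ) : ℂ) + ((32 * b : ℤ) : ℂ) * Complex.I := by
  refine ⟨-∑ τ ∈ pbox 0, ω τ, -∑ τ ∈ pbox (Pi.single 0 1), ω τ, ?_⟩
  rw [moment_one_eq_boxSums _ hK, boxSum_intCast, boxSum_intCast]
  push_cast; ring

/-- **the gap**: `μ ≠ 0 ⇒ ‖μ‖ ≥ 32`. -/
theorem norm_moment_one_ge (ω : PT → ℤ) (hK : ∀ k, KAdm k → moment (fun τ => (ω τ : ℝ)) k = 0)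
    (hμ : moment (fun τ => (ω τ : ℝ)) (fun _ => 1) ≠ 0) : 32 ≤ ‖moment (fun τ => (ω τ : ℝ)) (fun _ => 1)‖ := by
  obtain ⟨a, b, hab⟩ := moment_one_mem_32 ω hK
  rw [hab] at hμ ⊢
  have hne : a ≠ 0 ∨ b ≠ 0 := by
    by_contra h
    push Not at h
    obtain ⟨rfl, rfl⟩ := h
    simp at hμ
  have hsq : (1 : ℝ) ≤ (a : ℝ) ^ 2 + (b : ℝ) ^ 2 := by
    have h1 : (1 : ℤ) ≤ a ^ 2 + b ^ 2 := by
      rcases hne with h | h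
      · have := Int.one_le_abs h; nlinarith [sq_abs a, sq_nonneg b, abs_nonneg a]
      · have := Int.one_le_abs h; nlinarith [sq_abs b, sq_nonneg a, abs_nonneg b]
    exact_mod_cast h1
  have key : (32 : ℝ) ^ 2 ≤ ‖((32 * a : ℤ) : ℂ) + ((32 * b : ℤ) : ℂ) * Complex.I‖ ^ 2 := by
    rw [Complex.sq_norm, Complex.normSq_apply]
    simp
    nlinarith [hsq]
  nlinarith [norm_nonneg (((32 * a : ℤ) : ℂ) + ((32 * b : ℤ) : ℂ) * Complex.I), key]

end Summit.Ventures.HSemireg.PhaseTorus
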